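import Summits.QuantumFields.YangMills.Theorems.UnitScaleTiltProp7SectET3CurvedPropagatorsT3
import Summits.QuantumFields.YangMills.Theorems.UnitScaleTiltProp7SectET3DeltaEtaExplicitT3
import Summits.QuantumFields.YangMills.Theorems.UnitScaleTiltProp7SecondOrderDictT3
import Summits.QuantumFields.YangMills.Theorems.UnitScaleTiltProp7LandauCombDict
import HarnessLib

/-!
# Route `UnitScaleTilt`, crux K1 «MinimiserStabilityRegPr» (stmt-QuantumFields-19200), EX face after S45, the ONE-FORM VALUE storey — **O1: THE MEMBER's ONE-FORM OPERATOR
# `Δ_a(U₀) = Δx(U₀) + D_{U₀}R_S(U₀)D*_{U₀} + a·Qk†Qk` (the inverse of `GT`∕`H1f`∕`frakGf`∕`KinvT`'s `G`) IN KATO FORM: COMPONENTWISE IT IS THE COVARIANT SITE LAPLACIAN `Δ^η_{U₀}` OF V1,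
# UP TO A DISPLAYED FOUR-TERM REMAINDER `q = η⁻²(Δ′₁ − 𝒦) + (Δx − Δ^η_Wilson) − D(1 − R_S)D* + a·Qk†Qk`** — [Balaban1985Variational] (134)–(135) p.298 read at the member through the tree's
# Weitzenböck (★px16 ✓`Prop7SecondOrderDict.covCodiffCurlT_add_gradDiv_eq` = lit ✓`B11Eq135Weitzenbock.eq135_torus`), px5 g0's ✓`symm_DeltaEta_toL2_apply` (`Δ^η = η⁻²(D¹*D¹ + Δ′₁)`), and the
# `D`∕`D*`∕`Δ^η` dictionaries ✓`DL2_toL2S_eq_covDerivFwdT` ∕ ✓`DstarL2_toL2_eq_covDivFormT` ∕ ✓`covLapSite_toL2S_eq` (px5 g12 LOCATE-ONEFORM-VALUE e62c4fbc §3; ★p1 g26 06:19:10Z «O1 → O2»)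

Cell `ym3-torus` (HUMAN RULING D-0037; rung R3 = SU(2) YM₃ on T³ — NOT d = 4, NOT infinite volume, NOT a mass gap, NOT Clay).  Width seat `ym3-torus-px5` (gen 12).
THEOREMS ONLY (0 `def`, 0 `sorry`); `--supports stmt-QuantumFields-19200 --as helper`; count-neutral.

WHY.  The VALUE halves of the one-form EX rows (`norm_G`, `norm_H₁`, `norm_Hπ`, `h133`; the `KinvT`∕`GT` rows) are sup bounds for `G = Δ_a⁻¹` on BOND fields.  The engine is lit
✓`B9Eq342SupNormBootstrapLinf.norm_le_of_kato_bootstrap_linf` (Kato form + an `L^∞` perturbation letter), and V1 ✓`Prop7KatoBootstrapMember` showed that the member's SITE Laplacian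
`covLapSite U₀` IS a Kato form (`covLapSite_eq` + lit `equiv_covLaplaceSiteK_eq_sum`).  Print's (135): `D*D + DD* = Δ_{U₀} − 𝒦` with `Δ_{U₀}` the COMPONENTWISE covariant site Laplacian; so for
every component `ν`, the site function `X_ν = formComp X ν` of a bond field `X` satisfies `Δ^η_{U₀}(toL2S X_ν) = toL2S((Δ_aX)_ν) − toL2S(q_ν)` with an explicit LOCAL + NONLOCAL remainder
`q`.  THIS FILE is that identity — O2 (the chair ★p1 g26) runs V1's bootstrap per component with `q_ν` in the perturbation slots (local part `η⁻²(Δ′₁ − 𝒦)` = `O(ε₀)·sup‖X‖` on `RegPr`,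
§3 here; `Δx − Δ^η`, `D(1−R_S)D*`, `aQk†Qk` displayed ∕ V6-class).
WHAT IS PROVED (ns `Summit.QuantumFields.YangMills.Theorems.Prop7OneFormKatoForm`; member `F`, `h : n ≤ K`, weights `c₀ cB`, ANY background `U₀`, ANY slot `Δx`, any `a`;
`V := bgUnits F K U₀`, `T := torusT (F.P K) 0`, `U := fun μ x ↦ V ⟨x, μ⟩`).
* §1 `laplaceA_apply_eq` (`Δ_a Y = Δx Y + D(R_S(D*Y)) + Qk†(a•Qk Y)`, `rfl`), `DstarL2_toL2_eq_toL2S_covDivFormT` (`D*(toL2 X) = toL2S(D^{η*}_V X)`), `symm_DL2_DstarL2_toL2_apply`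
  (`toL2⁻¹(D D*(toL2 X)) b = η⁻²·D¹_{b.dir}(D¹*_V X)(b.src)`), `covDivFormT_eta_eq_smul`.
* §2 ★★★ `symm_laplaceA_toL2_apply` — FOR EVERY bond `b`:
  `toL2⁻¹(Δ_a(toL2 X)) b = η⁻²•(Δ¹_V X)_{b.dir}(b.src) + [η⁻²•((Δ′₁X) − (𝒦X))(b) + toL2⁻¹((Δx U₀ − Δ^η)(toL2 X)) b − toL2⁻¹(D(D*(toL2X) − R_S(D*(toL2 X)))) b + toL2⁻¹(Qk†(a•Qk(toL2 X))) b]`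
  — `Δ¹_V = covLapFormT 1 V` = lit `vecLap` (✓`covLapFormT_one_eq`) = V1's Kato form componentwise.
* §2 ★★★ `covLapSite_toL2S_formComp_eq` — THE `hu` OF O2, PER COMPONENT: if `Δ_a(toL2 X) = toL2 Y` then for every `ν`,
  `covLapSite U₀ (toL2S (formComp X ν)) = toL2S (formComp Y ν) − toL2S (fun x ↦ q ⟨x, ν⟩)` with `q` the displayed bracket of §2 — EXACTLY V1's hypothesis shape `Δ^η u = f − q`.
* §3 ★ `norm_local_remainder_le_of_regPr` — on `RegPr F n K ε₀ U₀`, `‖η⁻²•((Δ′₁X) − (𝒦X))(b)‖ ≤ 32·ε₀·sup‖X‖` (✓`norm_deltaPrimeOp_le_of_regPr` `28ε₀η²` + ✓`norm_covCodiffCurlT_sub_covLapFormT_add_gradDiv_le_of_regPr`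
  `4ε₀η²`, `η⁻²η² = 1`) — the `p_∞` letter of the linf bootstrap, SMALL.
HYP-SAT (★★OWNER RULING №42): §1–§2 have NO hypotheses beyond the letters' types (identities for every `U₀`, `Δx`, `a`, `X`); §3's `RegPr` is the member's class; nothing eventual, non-vacuous.
HONEST SCOPE.  Operator algebra over landed dictionaries; no estimate beyond §3's elementary local letter; nothing of the one-form value row (O2), the ten EX rows, `hT`, `hGF`, EX
`stub_existenceMinimalOrbit` or the crux is proved here; the Yang–Mills mass gap is NOT proved.

References: T. Bałaban, CMP **102** (1985) 277–309 [Balaban1985Variational] ((110) p.294, (134)–(136) p.298, (140) p.299, (14) p.280); CMP **99** (1985) 389–434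
[Balaban1985BackgroundPropagators] ((3.8)–(3.10) p.392, (3.23)–(3.26) pp.394–395, Thm 3.1 (3.42) p.397, Thm 3.12 p.423).
-/

set_option autoImplicit false

noncomputable section

open scoped BigOperators Matrix.Norms.L2Operator InnerProductSpace ComplexConjugate

namespace Summit.QuantumFields.YangMills.Theorems.Prop7OneFormKatoForm

open Literature.MathematicalPhysics.QuantumFieldTheory.Balaban1983to89
open Literature.MathematicalPhysics.QuantumFieldTheory.Balaban1983to89.T3ContinuumYM3Torus
open Literature.MathematicalPhysics.QuantumFieldTheory.Balaban1983to89.T3PrintedRegularMinimiser (RegPr)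
open T3SectALandauChart (formComp bgUnits covDerivFwdT covDivFormT covLapFormT covCodiffCurlT eta eta_pos)
open B10Eq68TorusRegularity (covDerivT)
open B9TorusCalculus (torusT)
open B9Eq310Hermitian (deltaPrimeOp)
open B11Eq135Weitzenbock (curvOp)
open B11Eq103H1Complex (SiteL2K BondL2K laplaceAK_apply)
open Summit.QuantumFields.YangMills.Theorems.Prop7SectET3Transport (periodsT3)
open Summit.QuantumFields.YangMills.Theorems.Prop7SectET3HilbertLetters (W₂ toL2 toL2S DL2 DstarL2 covLapSite)
open Summit.QuantumFields.YangMills.Theorems.Prop7SectET3WilsonHessian (DeltaEta)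
open Summit.QuantumFields.YangMills.Theorems.Prop7SectET3GaugeProjector (RS)
open Summit.QuantumFields.YangMills.Theorems.Prop7SectET3CurvedPropagators (Qk laplaceA)
open Summit.QuantumFields.YangMills.Theorems.Prop7SectET3DeltaEtaExplicit (symm_DeltaEta_toL2_apply norm_deltaPrimeOp_le_of_regPr)
open Summit.QuantumFields.YangMills.Theorems.Prop7SecondOrderDict (covCodiffCurlT_add_gradDiv_eq norm_covCodiffCurlT_sub_covLapFormT_add_gradDiv_le_of_regPr)
open Summit.QuantumFields.YangMills.Theorems.Prop7LandauDict (DL2_toL2S_eq_covDerivFwdT DstarL2_toL2_eq_covDivFormT)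
open Summit.QuantumFields.YangMills.Theorems.Prop7SPrintIn19 (covDerivFwdT_smul)

variable (F : T3Family) {n K : ℕ} (h : n ≤ K) (c₀ cB : ℝ) [Fact (0 < c₀)] [Fact (0 < cB)] (a : ℝ)
  (Δx : GaugeField (F.P K) 0 (Matrix.specialUnitaryGroup (Fin 2) ℂ) → (BondL2K ℂ 3 (periodsT3 F K) c₀ W₂ →ₗ[ℂ] BondL2K ℂ 3 (periodsT3 F K) c₀ W₂))
  (U₀ : GaugeField (F.P K) 0 (Matrix.specialUnitaryGroup (Fin 2) ℂ))

/-! ## §1 Unfoldings and the `D D*` dictionary -/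

/-- `Δ_a Y = Δx Y + D_{U₀}(R_S(D*_{U₀}Y)) + Qk†(a • Qk Y)` (lit `laplaceAK_apply` through `laplaceALatticeK`). [cite: Balaban1985BackgroundPropagators, (3.26) p.395; Balaban1985Variational, (110) p.294] -/
theorem laplaceA_apply_eq (Y : BondL2K ℂ 3 (periodsT3 F K) c₀ W₂) :
    laplaceA F n K h c₀ cB a Δx U₀ Y
      = Δx U₀ Y + DL2 F n K c₀ U₀ (RS F n K h c₀ cB U₀ (DstarL2 F n K c₀ U₀ Y)) + LinearMap.adjoint (Qk F n K h c₀ cB U₀) (((a : ℝ) : ℂ) • Qk F n K h c₀ cB U₀ Y) := rfl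

omit [Fact (0 < cB)] in
/-- `D*_{U₀}(toL2 X) = toL2S(D^{η*}_V X)` (✓`DstarL2_toL2_eq_covDivFormT`, as an identity of `L²` vectors). [cite: Balaban1985BackgroundPropagators, (3.8) p.392] -/
theorem DstarL2_toL2_eq_toL2S_covDivFormT (X : PBond (F.P K) 0 → Matrix (Fin 2) (Fin 2) ℂ) :
    DstarL2 F n K c₀ U₀ (toL2 F K c₀ X) = toL2S F K c₀ (covDivFormT (eta F n K) (bgUnits F K U₀) X) :=
  (LinearEquiv.symm_apply_eq _).mp (funext fun x => DstarL2_toL2_eq_covDivFormT F n K c₀ U₀ X x)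

omit [Fact (0 < c₀)] [Fact (0 < cB)] in
/-- `D^{η*}_V X = η⁻¹ • D^{1*}_V X` pointwise. [cite: Balaban1985BackgroundPropagators, (3.8) p.392] -/
theorem covDivFormT_eta_eq_smul (X : PBond (F.P K) 0 → Matrix (Fin 2) (Fin 2) ℂ) (x : Site (F.P K) 0) :
    covDivFormT (eta F n K) (bgUnits F K U₀) X x = (eta F n K)⁻¹ • covDivFormT 1 (bgUnits F K U₀) X x := by
  simp only [covDivFormT, covDerivT, inv_one, one_smul, Finset.smul_sum]

omit [Fact (0 < cB)] in
/-- `toL2⁻¹(D_{U₀}(D*_{U₀}(toL2 X))) b = η⁻¹ • η⁻¹ • D¹_{V,b.dir}(D^{1*}_V X)(b.src)` — the `DD*` member of (135) at the member's η-scaling.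
[cite: Balaban1985BackgroundPropagators, (3.3) p.391, (3.8) p.392; Balaban1985Variational, (135) p.298] -/
theorem symm_DL2_DstarL2_toL2_apply (X : PBond (F.P K) 0 → Matrix (Fin 2) (Fin 2) ℂ) (b : PBond (F.P K) 0) :
    (toL2 F K c₀).symm (DL2 F n K c₀ U₀ (DstarL2 F n K c₀ U₀ (toL2 F K c₀ X))) b
      = (eta F n K)⁻¹ • (eta F n K)⁻¹ • covDerivFwdT 1 (bgUnits F K U₀) b.dir (covDivFormT 1 (bgUnits F K U₀) X) b.src := by
  rw [DstarL2_toL2_eq_toL2S_covDivFormT, DL2_toL2S_eq_covDerivFwdT, T3SectALandauChart.covDerivFwdT_eq_smul]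
  have hfun : covDivFormT (eta F n K) (bgUnits F K U₀) X = fun x => (eta F n K)⁻¹ • covDivFormT 1 (bgUnits F K U₀) X x :=
    funext fun x => covDivFormT_eta_eq_smul F U₀ X x
  rw [hfun, covDerivFwdT_smul]

/-! ## §2 The Kato form of `Δ_a` -/

/-- ★★★ **THE ONE-FORM OPERATOR READ BACK ON THE BONDS IS THE COMPONENTWISE SITE LAPLACIAN PLUS A DISPLAYED REMAINDER** ([Balaban1985Variational] (134)–(135) at the member):
for every bond field `X` and bond `b`,
`toL2⁻¹(Δ_a(toL2 X)) b = η⁻¹•η⁻¹•(Δ¹_V X)_{b.dir}(b.src) + (η⁻¹•η⁻¹•((Δ′₁X)(b) − (𝒦X)(b)) + toL2⁻¹((Δx U₀ − Δ^η)(toL2 X)) b − toL2⁻¹(D(D*(toL2 X) − R_S(D*(toL2 X)))) b + toL2⁻¹(Qk†(a•Qk(toL2 X))) b)`.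
[cite: Balaban1985Variational, (134)–(135) p.298, (140) p.299; Balaban1985BackgroundPropagators, (3.10) p.392, (3.26) p.395] -/
theorem symm_laplaceA_toL2_apply (X : PBond (F.P K) 0 → Matrix (Fin 2) (Fin 2) ℂ) (b : PBond (F.P K) 0) :
    (toL2 F K c₀).symm (laplaceA F n K h c₀ cB a Δx U₀ (toL2 F K c₀ X)) b
      = (eta F n K)⁻¹ • (eta F n K)⁻¹ • covLapFormT 1 (bgUnits F K U₀) X b.dir b.src
        + ((eta F n K)⁻¹ • (eta F n K)⁻¹ •
              (deltaPrimeOp (torusT (F.P K) 0) (fun μ x => bgUnits F K U₀ ⟨x, μ⟩) 1 (formComp X) b.dir b.src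
                - curvOp (torusT (F.P K) 0) (fun μ x => bgUnits F K U₀ ⟨x, μ⟩) (formComp X) b.dir b.src)
            + (toL2 F K c₀).symm ((Δx U₀ - (DeltaEta F n K c₀ U₀ : BondL2K ℂ 3 (periodsT3 F K) c₀ W₂ →ₗ[ℂ] BondL2K ℂ 3 (periodsT3 F K) c₀ W₂)) (toL2 F K c₀ X)) b
            - (toL2 F K c₀).symm (DL2 F n K c₀ U₀ (DstarL2 F n K c₀ U₀ (toL2 F K c₀ X) - RS F n K h c₀ cB U₀ (DstarL2 F n K c₀ U₀ (toL2 F K c₀ X)))) b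
            + (toL2 F K c₀).symm (LinearMap.adjoint (Qk F n K h c₀ cB U₀) (((a : ℝ) : ℂ) • Qk F n K h c₀ cB U₀ (toL2 F K c₀ X))) b) := by
  -- split `Δ_a` and read every piece back on the bonds
  have hsplit : laplaceA F n K h c₀ cB a Δx U₀ (toL2 F K c₀ X)
      = (DeltaEta F n K c₀ U₀ : BondL2K ℂ 3 (periodsT3 F K) c₀ W₂ →ₗ[ℂ] BondL2K ℂ 3 (periodsT3 F K) c₀ W₂) (toL2 F K c₀ X)
        + (Δx U₀ - (DeltaEta F n K c₀ U₀ : BondL2K ℂ 3 (periodsT3 F K) c₀ W₂ →ₗ[ℂ] BondL2K ℂ 3 (periodsT3 F K) c₀ W₂)) (toL2 F K c₀ X)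
        + (DL2 F n K c₀ U₀ (DstarL2 F n K c₀ U₀ (toL2 F K c₀ X))
            - DL2 F n K c₀ U₀ (DstarL2 F n K c₀ U₀ (toL2 F K c₀ X) - RS F n K h c₀ cB U₀ (DstarL2 F n K c₀ U₀ (toL2 F K c₀ X))))
        + LinearMap.adjoint (Qk F n K h c₀ cB U₀) (((a : ℝ) : ℂ) • Qk F n K h c₀ cB U₀ (toL2 F K c₀ X)) := by
    rw [laplaceA_apply_eq, LinearMap.sub_apply, map_sub]; abel
  -- the Wilson Hessian piece: `η⁻²(D¹*D¹ + Δ′₁)` (px5 g0)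
  have hΔ := symm_DeltaEta_toL2_apply (n := n) (c₀ := c₀) U₀ X b
  -- the `DD*` piece
  have hDD := symm_DL2_DstarL2_toL2_apply F (n := n) c₀ U₀ X b
  -- Weitzenböck (135) in the route's letters (★px16)
  have hW := covCodiffCurlT_add_gradDiv_eq (bgUnits F K U₀) X b.dir b.src
  -- real vs complex scalars
  have hcast : ((((eta F n K)⁻¹ ^ 2 : ℝ) : ℂ)) • (covCodiffCurlT 1 (bgUnits F K U₀) X b.dir b.src
        + deltaPrimeOp (torusT (F.P K) 0) (fun μ x => bgUnits F K U₀ ⟨x, μ⟩) 1 (formComp X) b.dir b.src)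
      = (eta F n K)⁻¹ • (eta F n K)⁻¹ • (covCodiffCurlT 1 (bgUnits F K U₀) X b.dir b.src
        + deltaPrimeOp (torusT (F.P K) 0) (fun μ x => bgUnits F K U₀ ⟨x, μ⟩) 1 (formComp X) b.dir b.src) := by
    rw [Complex.coe_smul, sq, mul_smul]
  rw [hsplit, map_add, map_add, map_add, Pi.add_apply, Pi.add_apply, Pi.add_apply]
  have hDeq : (toL2 F K c₀).symm ((DeltaEta F n K c₀ U₀ : BondL2K ℂ 3 (periodsT3 F K) c₀ W₂ →ₗ[ℂ] BondL2K ℂ 3 (periodsT3 F K) c₀ W₂) (toL2 F K c₀ X)) b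
      = (eta F n K)⁻¹ • (eta F n K)⁻¹ • (covCodiffCurlT 1 (bgUnits F K U₀) X b.dir b.src
        + deltaPrimeOp (torusT (F.P K) 0) (fun μ x => bgUnits F K U₀ ⟨x, μ⟩) 1 (formComp X) b.dir b.src) := by
    rw [← hcast]; exact hΔ
  rw [hDeq, map_sub, Pi.sub_apply, hDD]
  -- `D¹*D¹ + D¹D¹* = Δ¹ − 𝒦`
  have hW' : covCodiffCurlT 1 (bgUnits F K U₀) X b.dir b.src
      = covLapFormT 1 (bgUnits F K U₀) X b.dir b.src
        - curvOp (torusT (F.P K) 0) (fun μ x => bgUnits F K U₀ ⟨x, μ⟩) (formComp X) b.dir b.src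
        - covDerivFwdT 1 (bgUnits F K U₀) b.dir (covDivFormT 1 (bgUnits F K U₀) X) b.src := by
    rw [← hW]; abel
  rw [hW']
  simp only [smul_add, smul_sub]
  abel

/-- ★★★ **THE `hu` OF THE ONE-FORM BOOTSTRAP, PER COMPONENT** — V1's hypothesis shape `Δ^η_{U₀} u = f − q` for `u := toL2S(X_ν)`: if `Δ_a(toL2 X) = toL2 Y` then for every direction `ν`,
`covLapSite U₀ (toL2S (formComp X ν)) = toL2S (formComp Y ν) − toL2S (q_ν)`, `q_ν(x)` = the displayed bracket of `symm_laplaceA_toL2_apply` at `b = ⟨x, ν⟩`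
(✓`covLapSite_toL2S_eq`: `Δ^η_{U₀}` on a site function IS `Δ^η_V` componentwise = `η⁻²Δ¹_V`). [cite: Balaban1985BackgroundPropagators, (3.23) p.394; Balaban1985Variational, (135) p.298] -/
theorem covLapSite_toL2S_formComp_eq (X Y : PBond (F.P K) 0 → Matrix (Fin 2) (Fin 2) ℂ)
    (hXY : laplaceA F n K h c₀ cB a Δx U₀ (toL2 F K c₀ X) = toL2 F K c₀ Y) (ν : Fin (F.P K).d) :
    covLapSite F n K c₀ U₀ (toL2S F K c₀ (formComp X ν))
      = toL2S F K c₀ (formComp Y ν)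
        - toL2S F K c₀ (fun x : Site (F.P K) 0 =>
            (eta F n K)⁻¹ • (eta F n K)⁻¹ •
              (deltaPrimeOp (torusT (F.P K) 0) (fun μ x => bgUnits F K U₀ ⟨x, μ⟩) 1 (formComp X) ν x
                - curvOp (torusT (F.P K) 0) (fun μ x => bgUnits F K U₀ ⟨x, μ⟩) (formComp X) ν x)
            + (toL2 F K c₀).symm ((Δx U₀ - (DeltaEta F n K c₀ U₀ : BondL2K ℂ 3 (periodsT3 F K) c₀ W₂ →ₗ[ℂ] BondL2K ℂ 3 (periodsT3 F K) c₀ W₂)) (toL2 F K c₀ X)) ⟨x, ν⟩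
            - (toL2 F K c₀).symm (DL2 F n K c₀ U₀ (DstarL2 F n K c₀ U₀ (toL2 F K c₀ X) - RS F n K h c₀ cB U₀ (DstarL2 F n K c₀ U₀ (toL2 F K c₀ X)))) ⟨x, ν⟩
            + (toL2 F K c₀).symm (LinearMap.adjoint (Qk F n K h c₀ cB U₀) (((a : ℝ) : ℂ) • Qk F n K h c₀ cB U₀ (toL2 F K c₀ X))) ⟨x, ν⟩) := by
  rw [Prop7LandauCombDict.covLapSite_toL2S_eq, ← map_sub]
  congr 1
  funext x
  -- the inner site function IS `Δ^η_V X` on the `ν`-component, `= η⁻²Δ¹_V X`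
  have hcomp : covDivFormT (eta F n K) (bgUnits F K U₀) (fun b : PBond (F.P K) 0 => covDerivFwdT (eta F n K) (bgUnits F K U₀) b.2 (formComp X ν) b.1) x
      = covLapFormT (eta F n K) (bgUnits F K U₀) X ν x := rfl
  rw [hcomp, Prop7SPrintIn19.covLapFormT_eq_smul]
  -- the bond identity at `b = ⟨x, ν⟩`, with `toL2⁻¹(Δ_a(toL2 X)) = Y`
  have hb := symm_laplaceA_toL2_apply F h c₀ cB a Δx U₀ X (⟨x, ν⟩ : PBond (F.P K) 0)
  rw [hXY, LinearEquiv.symm_apply_apply] at hb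
  simp only [Pi.sub_apply]
  rw [show formComp Y ν x = Y ⟨x, ν⟩ from rfl, hb]
  abel

/-! ## §3 The local remainder is `O(ε₀)·sup‖X‖` on the printed-regular class -/

omit [Fact (0 < c₀)] [Fact (0 < cB)] in
/-- ★ **THE `p_∞` LETTER**: on `RegPr F n K ε₀ U₀`, for `‖X(b)‖ ≤ s` everywhere, `‖η⁻¹•η⁻¹•((Δ′₁X)(b) − (𝒦X)(b))‖ ≤ 32·ε₀·s` — `28ε₀η²·s` (✓`norm_deltaPrimeOp_le_of_regPr`) plus `4ε₀η²·s`
(✓`norm_covCodiffCurlT_sub_covLapFormT_add_gradDiv_le_of_regPr`, the curvature operator of (135) read as `D¹*D¹ − (Δ¹ − D¹D¹*)`), times `η⁻²`.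
[cite: Balaban1985Variational, (14) p.280, (135)–(136) p.298, p.299; Balaban1985BackgroundPropagators, (3.10) p.392, (3.69) p.404] -/
theorem norm_local_remainder_le_of_regPr {ε₀ : ℝ} (hreg : RegPr F n K ε₀ U₀)
    {X : PBond (F.P K) 0 → Matrix (Fin 2) (Fin 2) ℂ} {s : ℝ} (hX : ∀ b, ‖X b‖ ≤ s) (b : PBond (F.P K) 0) :
    ‖(eta F n K)⁻¹ • (eta F n K)⁻¹ •
        (deltaPrimeOp (torusT (F.P K) 0) (fun μ x => bgUnits F K U₀ ⟨x, μ⟩) 1 (formComp X) b.dir b.src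
          - curvOp (torusT (F.P K) 0) (fun μ x => bgUnits F K U₀ ⟨x, μ⟩) (formComp X) b.dir b.src)‖ ≤ 32 * ε₀ * s := by
  have hη : 0 < eta F n K := eta_pos F n K
  have h1 := norm_deltaPrimeOp_le_of_regPr (F := F) (n := n) (K := K) U₀ hreg hX b.dir b.src
  -- the curvature operator as `−(D¹*D¹ − (Δ¹ − D¹D¹*))` (Weitzenböck (135), ★px16)
  have hW := covCodiffCurlT_add_gradDiv_eq (bgUnits F K U₀) X b.dir b.src
  have hK : curvOp (torusT (F.P K) 0) (fun μ x => bgUnits F K U₀ ⟨x, μ⟩) (formComp X) b.dir b.src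
      = -(covCodiffCurlT 1 (bgUnits F K U₀) X b.dir b.src
          - (covLapFormT 1 (bgUnits F K U₀) X b.dir b.src - covDerivFwdT 1 (bgUnits F K U₀) b.dir (covDivFormT 1 (bgUnits F K U₀) X) b.src)) := by
    have e : curvOp (torusT (F.P K) 0) (fun μ x => bgUnits F K U₀ ⟨x, μ⟩) (formComp X) b.dir b.src
        = covLapFormT 1 (bgUnits F K U₀) X b.dir b.src
          - (covCodiffCurlT 1 (bgUnits F K U₀) X b.dir b.src + covDerivFwdT 1 (bgUnits F K U₀) b.dir (covDivFormT 1 (bgUnits F K U₀) X) b.src) := by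
      rw [hW]; abel
    rw [e]; abel
  have h2 : ‖curvOp (torusT (F.P K) 0) (fun μ x => bgUnits F K U₀ ⟨x, μ⟩) (formComp X) b.dir b.src‖ ≤ 4 * ε₀ * eta F n K ^ 2 * s := by
    rw [hK, norm_neg]
    exact norm_covCodiffCurlT_sub_covLapFormT_add_gradDiv_le_of_regPr F n K U₀ hreg hX b.dir b.src
  rw [norm_smul, norm_smul, norm_inv, Real.norm_of_nonneg hη.le]
  have h3 : ‖deltaPrimeOp (torusT (F.P K) 0) (fun μ x => bgUnits F K U₀ ⟨x, μ⟩) 1 (formComp X) b.dir b.src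
        - curvOp (torusT (F.P K) 0) (fun μ x => bgUnits F K U₀ ⟨x, μ⟩) (formComp X) b.dir b.src‖ ≤ 32 * ε₀ * eta F n K ^ 2 * s := by
    refine (norm_sub_le _ _).trans ?_
    linarith [h1, h2]
  calc (eta F n K)⁻¹ * ((eta F n K)⁻¹ * ‖deltaPrimeOp (torusT (F.P K) 0) (fun μ x => bgUnits F K U₀ ⟨x, μ⟩) 1 (formComp X) b.dir b.src
          - curvOp (torusT (F.P K) 0) (fun μ x => bgUnits F K U₀ ⟨x, μ⟩) (formComp X) b.dir b.src‖)
      ≤ (eta F n K)⁻¹ * ((eta F n K)⁻¹ * (32 * ε₀ * eta F n K ^ 2 * s)) := by gcongr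
    _ = 32 * ε₀ * s := by field_simp

end Summit.QuantumFields.YangMills.Theorems.Prop7OneFormKatoForm

end
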